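import Summits.BirchSwinnertonDyer.BirchSwinnertonDyer.Theorems.SmallImageMuTransferMuTransferX9StepTwoLocal
import Summits.BirchSwinnertonDyer.BirchSwinnertonDyer.Theorems.SmallImageMuTransferMuTransferX9LocalTwistOperator
import Summits.BirchSwinnertonDyer.BirchSwinnertonDyer.Theorems.SmallImageMuTransferMuTransferX9TranslatePairing
import HarnessLib

/-!
# Transport kit for `stub_stepsTwoFourX9` (skeleton v5 of crux 19276 `MuTransferX9`): from the
# distinguished local Frobenius of `ℚ_q` to an ARBITRARY Frobenius `Fr` at an arbitrary prime `𝔓 ∣ q`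

Cell `b2b-bsdres` (X9 prover lineage, GEN 44) serving the K6 route `SmallImageMuTransfer` of cell
`bsd-smallim`. HONEST FRAMING: the cell deletes COMBINATION-SHAPED residual classes of the rank-≤1
BSD formula from PUBLISHED theorems only and TYPES the construction-shaped remainder; this is not
"finishing BSD"; class X9 stays TYPED at class level. `--supports` helper toward the registered stub
`stub_stepsTwoFourX9` of stmt-BirchSwinnertonDyer-19276 (skeleton v5, sha16 bbfcbeb8eb041500); books
nothing, closes nothing; theorems only (no definition, no named fact).

The registered stub `stub_stepsTwoFourX9` (k6-c2 g3, 13:39Z) concludes, for EVERY place `q ∉ S₁`,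
EVERY prime `𝔓 ∣ q` of `\bar ℤ` and EVERY arithmetic Frobenius `Fr` at `𝔓` with `ρ̄_{E,p}(Fr) = 1`,
`Fr ∈ Γ_n ∖ Γ_{n+1}`: `∃ U, p ∤ U(0) ∧ ∀ i, i + ε < 2e → C_i(U(S)·S^{e+a}·Φ(Fr), Ψc(Fr)) = 0`.  The
local theory that proves it (koly's `…X9Local*` files, the `q`-term of Lemma 1 (iii), the Kolyvagin
class of G3, the PT vanishing of x10's `…X9StepFour*`) lives at the DISTINGUISHED prime
`𝔓₀ = adicCompletionPrime ℚ q` and sees the values `Φ(res r)`, `Ψc(res r)` at a LOCAL Frobenius `r`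
of `ℚ_q` (`…X9StepTwoLocal`, p448257).  This file is the kit that moves the conclusion from
`(Φ(res r), Ψc(res r))` to `(Φ(Fr), Ψc(Fr))`:

* §1 (generic cocycle algebra, any `TopRep`): `apply_conj_eq_smul_sub` —
  `Φ(t r t⁻¹) = t·Φ(r) − ((t r t⁻¹)·Φ(t) − Φ(t))` (no triviality hypothesis);
  `apply_eq_of_mul_inv_mem_of_forall_apply_eq_zero` — `Φ(Fr) = Φ(τ)` when `τ·Fr⁻¹` lies in a subgroup
  (inertia) acting trivially and killed by `Φ`.
* §2 (any number field): `exists_forall_isAbsArithFrob_conj_mul_inv_mem_inertia` — for a Frobenius `Fr`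
  at `𝔓 ∣ v` there is `t` with `t·(res r)·t⁻¹·Fr⁻¹ ∈ I_𝔓` for EVERY local Frobenius `r` of `K_v` (raw
  inertia form of p448257 §2, no governing subgroup).
* §3 (generic twist algebra, k6-ty's `convCoeff` currency): `aeval_shiftEnd_twistModP_apply` (`U(S)`
  commutes with the twisted action); `twistModP_apply_sub_self_mem_range_of_depth` (`τ` with `ρ(τ) = 1`
  of depth `n`, `n + 1 ≤ J`: `τ·y − y ∈ S^{pⁿ}·𝒯_J` — the "`T^e`-ambiguity"); the ABSORPTION lemmas
  (`S^{pⁿ}`-ambiguities in either argument do not change `C_i(U(S)·S^m·x, y)` once `m + pⁿ ≥ J`); the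
  EQUIVARIANCE `convCoeff_aeval_shiftEnd_pow_twistModP_smul` (`C_i(U(S)S^m(g·x), g·y) = g·C_i(U(S)S^m x, y)`,
  from p448563).
* §4 **`forall_convCoeff_aeval_eq_zero_of_translate`** — the packaged transport: if
  `x' − g·x ∈ S^{e₀}·𝒯_J`, `y' − g·y ∈ S^{e₀}·𝒯'_J` and `J ≤ m + e₀`, then
  `(∀ i, i + ε < J → C_i(U(S)S^m x, y) = 0) → (∀ i, i + ε < J → C_i(U(S)S^m x', y') = 0)`; with §1–§2:
  `x' = Φ(Fr)`, `x = Φ(res r)`, `g = t`, `e₀ = e = pⁿ`, `m = e + a`.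

PARTITION (D-0054): X9 (A4) · X10∧¬Surj (A5) at `p = 3` (prime-generic statements) —
hypothesis-discharging helper toward `stub_stepsTwoFourX9`; closes NONE.

References: J.-P. Serre, *Local Fields*, I §8, VII §5 [SerreLocalFields1979]; J. Neukirch, *Algebraic
Number Theory*, I §9 (9.1), II §9 (9.6) [NeukirchANT1999]; B. Howard, Compos. Math. 140 (2004) Prop.
3.2.4 [Howard2004HeegnerKolyvagin]; B. Mazur, K. Rubin, Mem. AMS 799 (2004) §1.3 [MazurRubin2004];
L. Washington, *Cyclotomic Fields*, §13.2 [Washington1997]; HOME/koly/MU-TRANSFER-PROOF.md (F5), §5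
STEP 2 ("Another `𝔔` conjugates the pair …"; "`T^e`-ambiguities … harmless").
-/

-- the summit and its single problem are both named `BirchSwinnertonDyer` (registry layout D-0017)
set_option linter.dupNamespace false

set_option autoImplicit false

noncomputable section

open scoped NumberField
open Field WeierstrassCurve Literature.NumberTheory.EllipticCurves
  Literature.NumberTheory.GaloisRepresentations Function IsDedekindDomain NumberField Polynomial
open Literature.NumberTheory.GaloisRepresentations.IsNonarchimedeanLocalField
open Literature.NumberTheory.Automorphic

namespace Summit.BirchSwinnertonDyer.BirchSwinnertonDyer.Rank1Residual.StepsTwoFourTransport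

/-! ### §1 Cocycle algebra: conjugation by a non-trivially acting element; cosets of inertia -/

section Cocycle

universe u v

variable {R : Type u} [Ring R] [TopologicalSpace R]
variable {G : Type v} [Group G] [TopologicalSpace G]
variable {X : TopRep.{v} R G}

/-- **`Φ(t r t⁻¹) = t·Φ(r) − ((t r t⁻¹)·Φ(t) − Φ(t))`** for any continuous `1`-cocycle `Φ` and any
`t, r` — no triviality hypothesis: the correction term is `(τ − 1)·Φ(t)`, `τ = t r t⁻¹` (a
"`T^e`-ambiguity" when `τ − 1` acts as `T^e·unit`). [cite: SerreLocalFields1979, VII §5] -/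
theorem apply_conj_eq_smul_sub (Φ : contOneCocycles X) (t r : G) :
    Φ.1 (t * r * t⁻¹) = X.ρ t (Φ.1 r) - (X.ρ (t * r * t⁻¹) (Φ.1 t) - Φ.1 t) := by
  have h1 : Φ.1 (t * r * t⁻¹) = Φ.1 t + X.ρ t (Φ.1 (r * t⁻¹)) := by rw [mul_assoc, Φ.2 t (r * t⁻¹)]
  have h2 : Φ.1 (r * t⁻¹) = Φ.1 r + X.ρ r (Φ.1 t⁻¹) := Φ.2 r t⁻¹
  have h3 : Φ.1 t⁻¹ = -(X.ρ t⁻¹ (Φ.1 t)) := by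
    have h := Φ.2 t⁻¹ t
    rw [inv_mul_cancel, contOneCocycles.apply_one] at h
    exact eq_neg_of_add_eq_zero_left h.symm
  have h4 : X.ρ (t * r * t⁻¹) (Φ.1 t) = X.ρ t (X.ρ r (X.ρ t⁻¹ (Φ.1 t))) := by
    rw [map_mul, map_mul]
    rfl
  rw [h1, h2, h3, map_add, map_neg, map_neg, h4]
  abel

/-- **Two Frobenii at the same prime give the same value** of a cocycle vanishing on the inertia
group: if `τ·σ⁻¹ ∈ I` with `I` acting trivially on `X` and `Φ|_I = 0`, then `Φ(σ) = Φ(τ)`.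
[cite: SerreLocalFields1979, VII §5] -/
theorem apply_eq_of_mul_inv_mem_of_forall_apply_eq_zero (Φ : contOneCocycles X) {I : Subgroup G}
    (hIX : ∀ j ∈ I, ∀ x : X, X.ρ j x = x) (hI0 : ∀ j ∈ I, Φ.1 j = 0) {τ σ : G} (h : τ * σ⁻¹ ∈ I) :
    Φ.1 σ = Φ.1 τ := by
  have hσ : σ = (τ * σ⁻¹)⁻¹ * τ := by group
  rw [hσ, contOneCocycles.apply_mul_of_fixed Φ (hIX _ (I.inv_mem h)),
    contOneCocycles.apply_inv_of_fixed Φ (hIX _ h), hI0 _ h, neg_zero, zero_add]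

end Cocycle

/-! ### §2 Frobenius transport, raw inertia form (any number field) -/

section NumberField

universe u

variable {K : Type u} [Field K] [NumberField K]

/-- **From a Frobenius at `𝔓 ∣ v` to every local Frobenius of `K_v`, inertia form.**  For a prime
`𝔓 ∣ v` of `\bar ℤ_K` and an arithmetic Frobenius `Fr` at `𝔓` there is `t ∈ Γ_K` (`t • 𝔓₀ = 𝔓`,
`𝔓₀` the prime of the fixed embedding `K̄ → \bar K_v`) such that for EVERY arithmetic Frobenius `r` of
`K_v`: `t·(res r)·t⁻¹` is an arithmetic Frobenius at `𝔓` and `t·(res r)·t⁻¹·Fr⁻¹ ∈ I_𝔓`.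
[cite: NeukirchANT1999, Ch. I §9 Prop. (9.1) and Ch. II §9 Prop. (9.6)] [cite: SerreLocalFields1979, Ch. I §8] -/
theorem exists_forall_isAbsArithFrob_conj_mul_inv_mem_inertia {v : HeightOneSpectrum (𝓞 K)}
    {𝔓 : Ideal (absIntegers (𝓞 K) K)} (h𝔓 : 𝔓 ∈ v.primesAbove) {Fr : absoluteGaloisGroup K}
    (hFr : IsArithFrobAt (𝓞 K) Fr 𝔓) :
    ∃ t : absoluteGaloisGroup K, ∀ r : absoluteGaloisGroup (v.adicCompletion K), IsAbsArithFrob r →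
      IsArithFrobAt (𝓞 K) (t * absGaloisRestrict K (v.adicCompletion K) r * t⁻¹) 𝔓 ∧
        t * absGaloisRestrict K (v.adicCompletion K) r * t⁻¹ * Fr⁻¹ ∈ 𝔓.inertia (absoluteGaloisGroup K) := by
  classical
  haveI : 𝔓.IsPrime := h𝔓.1
  obtain ⟨t, ht⟩ := HeightOneSpectrum.exists_smul_eq_of_mem_primesAbove_holds
    (adicCompletionPrime_mem_primesAbove K v) h𝔓
  refine ⟨t, fun r hr => ?_⟩
  have hres : IsArithFrobAt (𝓞 K) (absGaloisRestrict K (v.adicCompletion K) r)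
      (adicCompletionPrime K v) :=
    (isArithFrobAt_absGaloisRestrict_adicCompletionPrime_iff K v
      (by rw [residueFieldCard_adicCompletion_eq K v, HeightOneSpectrum.residueCard_eq_card_quotient])
      r).2 hr
  have hconj : IsArithFrobAt (𝓞 K) (t * absGaloisRestrict K (v.adicCompletion K) r * t⁻¹) 𝔓 :=
    ht ▸ hres.conj t
  exact ⟨hconj, hconj.mul_inv_mem_inertia hFr⟩

end NumberField

/-! ### §3 Twist algebra: `U(S)`, depth ambiguities, absorption, equivariance -/

section Twist

universe u

variable {K : Type u} [Field K] {p : ℕ} [Fact p.Prime] (κ : ZpExtension K p)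
  {M M' P : Type u} [AddCommGroup M] [TopologicalSpace M] [DiscreteTopology M]
  [AddCommGroup M'] [TopologicalSpace M'] [DiscreteTopology M']
  [AddCommGroup P] [TopologicalSpace P] [DiscreteTopology P]
  (ρ : DiscreteGaloisModule K M) (ρ' : DiscreteGaloisModule K M') (ρP : DiscreteGaloisModule K P)
  (hM : ∀ x : M, p • x = 0) (hM' : ∀ x : M', p • x = 0) (J : ℕ)

/-- **`U(S)` commutes with the twisted action**: `U(S)(g·x) = g·(U(S) x)` for every `U ∈ ℤ[X]`
(the twisted action is `𝔽_p[T]/(T^J)`-linear; `shiftEnd_pow_twistModP_apply` termwise).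
[cite: Washington1997, §13.1–§13.2] -/
theorem aeval_shiftEnd_twistModP_apply (U : ℤ[X]) (g : absoluteGaloisGroup K) (x : Fin J → M) :
    aeval (shiftEnd M J) U (κ.twistModP ρ hM J g x) = κ.twistModP ρ hM J g (aeval (shiftEnd M J) U x) := by
  induction U using Polynomial.induction_on' with
  | add P Q hP hQ => rw [map_add, LinearMap.add_apply, LinearMap.add_apply, hP, hQ, map_add]
  | monomial n c =>
    rw [← C_mul_X_pow_eq_monomial, map_mul, map_pow, aeval_C, aeval_X, Module.End.mul_apply,
      Module.End.mul_apply, TranslatePairing.shiftEnd_pow_twistModP_apply,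
      Algebra.algebraMap_eq_smul_one, LinearMap.smul_apply, LinearMap.smul_apply,
      Module.End.one_apply, Module.End.one_apply, map_zsmul]

/-- **The `T^e`-ambiguity of an `E`-split element of depth `n`.**  If `ρ(τ) = 1` and
`τ ∈ Gal(K̄/K_n) ∖ Gal(K̄/K_{n+1})` (`n + 1 ≤ J`), then `τ·y − y ∈ S^{pⁿ}·𝒯_J` for every `y`
((F5) in operator form: `(1+S)^{pⁿu} − 1 = S^{pⁿ}·V`, koly `unipotentPow_sub_one_eq_shiftEnd_pow_mul_unit`).
[cite: Washington1997, §13.2 (arithmetic in Λ/(p, T^n))] -/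
theorem twistModP_apply_sub_self_mem_range_of_depth {τ : absoluteGaloisGroup K} (hρ : ρ τ = 1)
    {n : ℕ} (hn : n + 1 ≤ J) (hτ : τ ∈ κ.layerSubgroup n) (hτ' : τ ∉ κ.layerSubgroup (n + 1))
    (y : Fin J → M) :
    κ.twistModP ρ hM J τ y - y ∈ LinearMap.range (shiftEnd M J ^ (p ^ n)) := by
  obtain ⟨u, hu, hexp⟩ := LocalSplitPrime.twistExponent_eq_prime_pow_mul_of_depth κ hn hτ hτ'
  obtain ⟨V, -, -, hV⟩ :=
    LocalSplitPrime.unipotentPow_sub_one_eq_shiftEnd_pow_mul_unit (J := J) hM n u hu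
  have hy : κ.twistModP ρ hM J τ y = unipotentPow M J (p ^ n * u) y := by
    rw [ZpExtension.twistModP_apply, hexp]
    congr 1
    funext i
    rw [hρ, Module.End.one_apply]
  have h2 : κ.twistModP ρ hM J τ y - y = (unipotentPow M J (p ^ n * u) - 1) y := by
    rw [hy, LinearMap.sub_apply, Module.End.one_apply]
  rw [h2, hV, Module.End.mul_apply]
  exact LinearMap.mem_range_self _ _

omit [TopologicalSpace M] [DiscreteTopology M] [Fact p.Prime] in
/-- Absorption in the first argument: an `S^{e₀}`-ambiguity dies under `S^m` once `J ≤ m + e₀`.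
[cite: Washington1997, §13.1–§13.2] -/
theorem shiftEnd_pow_apply_add_of_mem_range {m e₀ : ℕ} (hJ : J ≤ m + e₀) (x : Fin J → M)
    {z : Fin J → M} (hz : z ∈ LinearMap.range (shiftEnd M J ^ e₀)) :
    (shiftEnd M J ^ m) (x + z) = (shiftEnd M J ^ m) x := by
  obtain ⟨w, rfl⟩ := hz
  rw [map_add, ← Module.End.mul_apply, ← pow_add, shiftEnd_pow_eq_zero hJ, LinearMap.zero_apply,
    add_zero]

omit [TopologicalSpace M] [DiscreteTopology M] [TopologicalSpace M'] [DiscreteTopology M']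
  [TopologicalSpace P] [DiscreteTopology P] [Fact p.Prime] in
/-- Absorption in the second argument: an `S^{e₀}`-ambiguity of `y` does not change
`C_i(U(S)·S^m·x, y)` for `i < J` once `J ≤ m + e₀` (`S` is self-adjoint for every `C_i`, k6-ty
`convCoeff_shiftEnd_pow_comm`, and `U(S)` commutes with `S`). [cite: MazurRubin2004, §1.3 and §5.3] -/
theorem convCoeff_aeval_shiftEnd_pow_add_right_of_mem_range {e : M →+ M' →+ P} {i m e₀ : ℕ}
    (hi : i < J) (hJ : J ≤ m + e₀) (U : ℤ[X]) (x : Fin J → M) (y : Fin J → M')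
    {z : Fin J → M'} (hz : z ∈ LinearMap.range (shiftEnd M' J ^ e₀)) :
    convCoeff e J i (aeval (shiftEnd M J) U ((shiftEnd M J ^ m) x)) (y + z) =
      convCoeff e J i (aeval (shiftEnd M J) U ((shiftEnd M J ^ m) x)) y := by
  obtain ⟨w, rfl⟩ := hz
  have hcomm : (shiftEnd M J ^ e₀) (aeval (shiftEnd M J) U ((shiftEnd M J ^ m) x)) = 0 := by
    rw [← Module.End.mul_apply, ((LocalSplitPrime.commute_aeval_self (shiftEnd M J) U).pow_left e₀).eq,
      Module.End.mul_apply, ← Module.End.mul_apply (shiftEnd M J ^ e₀), ← pow_add,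
      shiftEnd_pow_eq_zero (by omega : J ≤ e₀ + m), LinearMap.zero_apply, map_zero]
  rw [convCoeff_add_right, ← convCoeff_shiftEnd_pow_comm e hi, hcomm, convCoeff_def]
  simp [coeffFun]

/-- **Equivariance of the stub's pairing expression**: for every `i < J`, `U ∈ ℤ[X]`, `m`, `g`:
`C_i(U(S)·S^m·(g·x), g·y) = g·C_i(U(S)·S^m·x, y)` (p448563 `convCoeff_twistModP_smul` with §3's
commutation lemmas). [cite: Howard2004HeegnerKolyvagin, Prop. 3.2.4] [cite: MazurRubin2004, §1.3 and §5.3] -/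
theorem convCoeff_aeval_shiftEnd_pow_twistModP_smul {e : M →+ M' →+ P}
    (he : ∀ (g : absoluteGaloisGroup K) (m : M) (m' : M'), e (ρ g m) (ρ' g m') = ρP g (e m m'))
    {i : ℕ} (hi : i < J) (U : ℤ[X]) (m : ℕ) (g : absoluteGaloisGroup K) (x : Fin J → M)
    (y : Fin J → M') :
    convCoeff e J i (aeval (shiftEnd M J) U ((shiftEnd M J ^ m) (κ.twistModP ρ hM J g x)))
        (κ.invTwist.twistModP ρ' hM' J g y) =
      ρP g (convCoeff e J i (aeval (shiftEnd M J) U ((shiftEnd M J ^ m) x)) y) := by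
  rw [TranslatePairing.shiftEnd_pow_twistModP_apply, aeval_shiftEnd_twistModP_apply,
    TranslatePairing.convCoeff_twistModP_smul κ ρ ρ' ρP hM hM' J he hi]

end Twist

/-! ### §4 The packaged transport -/

section Transport

universe u

variable {K : Type u} [Field K] {p : ℕ} [Fact p.Prime] (κ : ZpExtension K p)
  {M M' P : Type u} [AddCommGroup M] [TopologicalSpace M] [DiscreteTopology M]
  [AddCommGroup M'] [TopologicalSpace M'] [DiscreteTopology M']
  [AddCommGroup P] [TopologicalSpace P] [DiscreteTopology P]
  (ρ : DiscreteGaloisModule K M) (ρ' : DiscreteGaloisModule K M') (ρP : DiscreteGaloisModule K P)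
  (hM : ∀ x : M, p • x = 0) (hM' : ∀ x : M', p • x = 0) (J : ℕ)
  {e : M →+ M' →+ P}
  (he : ∀ (g : absoluteGaloisGroup K) (m : M) (m' : M'), e (ρ g m) (ρ' g m') = ρP g (e m m'))

include he in
/-- **Transport of the stub's conclusion along a translate with `S^{e₀}`-ambiguities.**  Let
`x' − g·x ∈ S^{e₀}·𝒯_J(ρ, κ)`, `y' − g·y ∈ S^{e₀}·𝒯_J(ρ′, κ⁻¹)` and `J ≤ m + e₀`.  Then for every
`U ∈ ℤ[X]` and `ε`: if `C_i(U(S)·S^m·x, y) = 0` for all `i` with `i + ε < J`, the same holds at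
`(x', y')`.  In `stub_stepsTwoFourX9`: `x = Φ(res r)`, `y = Ψc(res r)` at a local Frobenius `r` of
`ℚ_q`, `x' = Φ(Fr)`, `y' = Ψc(Fr)` at any Frobenius `Fr` of any `𝔓 ∣ q` (`g = t`, §§1–2),
`e₀ = e = pⁿ` (§3 `twistModP_apply_sub_self_mem_range_of_depth`), `m = e + a`, `J = 2e`.
[cite: Howard2004HeegnerKolyvagin, Prop. 3.2.4] [cite: MazurRubin2004, §1.3 and §5.3]
[cite: Washington1997, §13.2 (arithmetic in Λ/(p, T^n))] -/
theorem forall_convCoeff_aeval_eq_zero_of_translate {m e₀ ε : ℕ} (hJ : J ≤ m + e₀) (U : ℤ[X])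
    (g : absoluteGaloisGroup K) {x x' : Fin J → M} {y y' : Fin J → M'}
    (hx : x' - κ.twistModP ρ hM J g x ∈ LinearMap.range (shiftEnd M J ^ e₀))
    (hy : y' - κ.invTwist.twistModP ρ' hM' J g y ∈ LinearMap.range (shiftEnd M' J ^ e₀))
    (h : ∀ i, i + ε < J → convCoeff e J i (aeval (shiftEnd M J) U ((shiftEnd M J ^ m) x)) y = 0) :
    ∀ i, i + ε < J → convCoeff e J i (aeval (shiftEnd M J) U ((shiftEnd M J ^ m) x')) y' = 0 := by
  intro i hi
  have hi' : i < J := by omega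
  have hx' : x' = κ.twistModP ρ hM J g x + (x' - κ.twistModP ρ hM J g x) := by abel
  have hy' : y' = κ.invTwist.twistModP ρ' hM' J g y + (y' - κ.invTwist.twistModP ρ' hM' J g y) := by
    abel
  rw [hx', hy', shiftEnd_pow_apply_add_of_mem_range J hJ _ hx,
    convCoeff_aeval_shiftEnd_pow_add_right_of_mem_range J hi' hJ U _ _ hy,
    convCoeff_aeval_shiftEnd_pow_twistModP_smul κ ρ ρ' ρP hM hM' J he hi' U m g x y, h i hi, map_zero]

include he in
/-- The same as an `iff` (translate back by `g⁻¹`-free symmetry is not needed: state both directions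
through the equivariance and the absorption; here the useful direction only, with the roles named as
in the stub). Existential-`U` form: the stub's `∃ U, ¬ p ∣ U.coeff 0 ∧ ∀ i, i + ε < J → … = 0`
transports verbatim. [cite: Howard2004HeegnerKolyvagin, Prop. 3.2.4] [cite: MazurRubin2004, §1.3 and §5.3] -/
theorem exists_forall_convCoeff_aeval_eq_zero_of_translate {m e₀ ε : ℕ} (hJ : J ≤ m + e₀)
    (g : absoluteGaloisGroup K) {x x' : Fin J → M} {y y' : Fin J → M'}
    (hx : x' - κ.twistModP ρ hM J g x ∈ LinearMap.range (shiftEnd M J ^ e₀))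
    (hy : y' - κ.invTwist.twistModP ρ' hM' J g y ∈ LinearMap.range (shiftEnd M' J ^ e₀))
    (h : ∃ U : ℤ[X], ¬ (p : ℤ) ∣ U.coeff 0 ∧
      ∀ i, i + ε < J → convCoeff e J i (aeval (shiftEnd M J) U ((shiftEnd M J ^ m) x)) y = 0) :
    ∃ U : ℤ[X], ¬ (p : ℤ) ∣ U.coeff 0 ∧
      ∀ i, i + ε < J → convCoeff e J i (aeval (shiftEnd M J) U ((shiftEnd M J ^ m) x')) y' = 0 := by
  obtain ⟨U, hU, hvan⟩ := h
  exact ⟨U, hU, forall_convCoeff_aeval_eq_zero_of_translate κ ρ ρ' ρP hM hM' J he hJ U g hx hy hvan⟩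

end Transport

end Summit.BirchSwinnertonDyer.BirchSwinnertonDyer.Rank1Residual.StepsTwoFourTransport

end
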